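import Literature.Barriers.CriticalPhenomena.TimarTargetForest
import Literature.Barriers.CriticalPhenomena.SubexponentialGrowthZdProofs
import HarnessLib

/-!
# Targets of the forest of encounter points exist, three separated branches give out-degree at
# least three, and the out-degree is at most the degree (Timár 2006, proof of Thm. 5.5) — PROVED

Barrier catalogue `Literature/Barriers/CriticalPhenomena/`; a deterministic brick of the
programme proving Timár's Thm. 5.5 (`Timar2006_finiteLevelUnion`,
`TimarCriticalNonunimodular.lean`), on top of the abstract target forest of
`TimarTargetForest.lean` (host graph `Γ`, points `W`, class relation `R`, labels `ℓ`; candidates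
`cand`, targets `IsTarget`, the pointing relation `Points`). Á. Timár, Ann. Probab. 34 (2006)
2344–2364, §5, proof of Thm. 5.5 (p. 2359):

> "For every `v ∈ W` and each component `I` of `Γ_W ∖ v` such that `I` is adjacent to `v` in
> `Γ_W`, choose uniformly a vertex of `I` that is closest to `v` in `ω`. Put a directed edge from
> `v` to this vertex. … every point `x` in `F` has degree `≥ 3` because each element of `W` is
> incident to at least one edge for each infinite component that results from the component of
> `x` after the deletion of `x`."

PROVED here, for `Γ ≤ G` with `G` locally finite (so that `Γ`-balls are finite):

* `exists_isTarget` — **targets exist**: a nonempty set of candidates has a target (a candidate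
  at minimal `Γ`-distance from `x` — the distances are well ordered — of minimal label among the
  finitely many candidates at that distance);
* `three_le_encard_setOf_points` — **out-degree `≥ 3`**: if `x ∈ W` has three vertices in
  pairwise different branches whose candidate sets are nonempty (Lemma 5.3: each heavy branch at
  an encounter point contains an encounter point of the class of `x`), then `x` points to at least
  three targets (targets in different branches are different);
* `encard_setOf_points_le_degree` — **out-degree `≤ deg x`**: the first step of a path from `x`
  to a target is a neighbour of `x` in the branch of the target, and different targets lie in
  different branches (targets are unique per branch, `IsTarget.unique`, labels injective on `W`).

## References

* Á. Timár, Ann. Probab. 34 (2006) 2344–2364 (arXiv:math/0702875), §5, proof of Thm. 5.5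
  (construction of `M⃗`; "every point `x` in `F` has degree `≥ 3`"). [Timar2006]
-/

namespace Literature.Barriers.CriticalPhenomena

open SimpleGraph

variable {V : Type*} {G : SimpleGraph V} [G.LocallyFinite] {Γ : SimpleGraph V} {W : Set V}
  {R : V → V → Prop} {ℓ : V → ℝ}

/-- In a subgraph of a locally finite graph the vertices within `Γ`-distance `n` of `x` are
finitely many (they lie in the ball `B_G(x, n)`). [folklore] -/
theorem finite_setOf_edist_le (hΓ : Γ ≤ G) (x : V) (n : ℕ) :
    ({z | Γ.edist x z ≤ n} : Set V).Finite := by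
  refine (graphBall_finite G x n).subset fun z hz => ?_
  have h1 : G.edist x z ≤ n := (edist_anti hΓ).trans hz
  have hr : G.Reachable x z := by
    rw [← edist_ne_top_iff_reachable]
    exact ne_top_of_le_ne_top (ENat.coe_ne_top n) h1
  obtain ⟨w, hw⟩ := hr.exists_walk_length_eq_edist
  refine ⟨w, ?_⟩
  have : (w.length : ℕ∞) ≤ n := hw ▸ h1
  exact_mod_cast this

/-- **Targets exist**: a nonempty candidate set has a target — a candidate at minimal distance
from `x` with the least label among the (finitely many) candidates at that distance ("choose … a
vertex of `I` that is closest to `v` in `ω`", ties broken by the labels).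
[cite: Timar2006, Thm. 5.5 (proof: construction of M⃗)] -/
theorem exists_isTarget (hΓ : Γ ≤ G) {x u : V} (hne : (cand Γ W R x u).Nonempty) :
    ∃ t, IsTarget Γ W R ℓ x u t := by
  classical
  -- a candidate at minimal distance
  obtain ⟨z₁, hz₁, hmin⟩ := WellFounded.has_min (InvImage.wf (fun z => Γ.edist x z) wellFounded_lt)
    (cand Γ W R x u) hne
  have hdT : Γ.edist x z₁ ≠ ⊤ := edist_ne_top_iff_reachable.2 hz₁.2.1
  obtain ⟨n, hn⟩ := ENat.ne_top_iff_exists.1 hdT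
  -- the finitely many candidates at that distance
  set T : Set V := {z | z ∈ cand Γ W R x u ∧ Γ.edist x z = n} with hT
  have hTfin : T.Finite := (finite_setOf_edist_le hΓ x n).subset fun z hz => hz.2.le
  have hTne : hTfin.toFinset.Nonempty := ⟨z₁, hTfin.mem_toFinset.2 ⟨hz₁, hn.symm⟩⟩
  obtain ⟨t, ht, htmin⟩ := hTfin.toFinset.exists_min_image ℓ hTne
  rw [hTfin.mem_toFinset] at ht
  refine ⟨t, ht.1, fun z hz => ?_⟩
  have hle : Γ.edist x t ≤ Γ.edist x z := by
    rw [ht.2, hn]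
    exact not_lt.1 (hmin z hz)
  rcases hle.lt_or_eq with hlt | heq
  · exact Or.inl hlt
  · refine Or.inr ⟨heq, htmin z (hTfin.mem_toFinset.2 ⟨hz, ?_⟩)⟩
    rw [← heq, ht.2]

/-- **Three separated branches with candidates give out-degree at least three**: if `x ∈ W` and
`u₀, u₁, u₂` lie in pairwise different branches at `x`, each with a nonempty candidate set, then
`x` points to at least three targets ("every point `x` in `F` has degree `≥ 3` because each
element of `W` is incident to at least one edge for each … component").
[cite: Timar2006, Thm. 5.5 (proof: degrees ≥ 3 in F)] -/
theorem three_le_encard_setOf_points (hΓ : Γ ≤ G) {x : V} (hx : x ∈ W) (u : Fin 3 → V)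
    (hsep : ∀ i j, AvoidReach Γ x (u i) (u j) → i = j)
    (hne : ∀ i, (cand Γ W R x (u i)).Nonempty) :
    3 ≤ ({t | Points Γ W R ℓ x t} : Set V).encard := by
  classical
  choose t ht using fun i => exists_isTarget (ℓ := ℓ) hΓ (hne i)
  have hinj : Function.Injective t := by
    intro i j hij
    refine hsep i j ?_
    have hi : AvoidReach Γ x (u i) (t i) := (ht i).1.1
    have hj : AvoidReach Γ x (u j) (t j) := (ht j).1.1
    rw [hij] at hi
    exact hi.trans hj.symm
  have hsub : (↑(Finset.univ.image t) : Set V) ⊆ {t | Points Γ W R ℓ x t} := by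
    intro z hz
    rw [Finset.coe_image, Finset.coe_univ, Set.image_univ] at hz
    obtain ⟨i, rfl⟩ := hz
    exact ⟨hx, u i, ht i⟩
  calc (3 : ℕ∞) = ((Finset.univ.image t).card : ℕ∞) := by
        rw [Finset.card_image_of_injective _ hinj, Finset.card_univ, Fintype.card_fin]; rfl
    _ = (↑(Finset.univ.image t) : Set V).encard := (Set.encard_coe_eq_coe_finsetCard _).symm
    _ ≤ ({t | Points Γ W R ℓ x t} : Set V).encard := Set.encard_le_encard hsub

/-- **The out-degree is at most the degree**: `x` points to at most `deg_G x` targets — the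
first step of a path from `x` to a target is a `Γ`-neighbour of `x` in the branch of the target,
and targets in a common branch coincide (labels injective on `W`).
[cite: Timar2006, Thm. 5.5 (proof: one edge for each component of Γ_W ∖ v)] -/
theorem encard_setOf_points_le_degree (hΓ : Γ ≤ G) (hℓ : Set.InjOn ℓ W) (x : V) :
    ({t | Points Γ W R ℓ x t} : Set V).encard ≤ (G.degree x : ℕ∞) := by
  classical
  -- first steps
  have hstep : ∀ t, Points Γ W R ℓ x t → ∃ v, Γ.Adj x v ∧ AvoidReach Γ x v t := by
    rintro t ⟨-, u, htar⟩
    have hne : x ≠ t := (htar.1.1.ne_right).symm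
    obtain ⟨q⟩ := (htar.1.2.1 : Γ.Reachable x t)
    obtain ⟨v, hadj, p', hp'⟩ := q.bypass.exists_eq_cons_of_ne hne
    have hpath := q.bypass_isPath
    rw [hp', Walk.cons_isPath_iff] at hpath
    exact ⟨v, hadj, p', hpath.2⟩
  choose! f hf using hstep
  have hmaps : Set.MapsTo f {t | Points Γ W R ℓ x t} ↑(G.neighborFinset x) := by
    intro t ht
    rw [Finset.mem_coe, mem_neighborFinset]
    exact hΓ (hf t ht).1
  have hinj : Set.InjOn f {t | Points Γ W R ℓ x t} := by
    intro t ht t' ht' hff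
    have h1 := (hf t ht).2
    have h2 := (hf t' ht').2
    rw [hff] at h1
    have htt' : AvoidReach Γ x t t' := h1.symm.trans h2
    obtain ⟨-, u, htar⟩ := ht
    obtain ⟨-, u', htar'⟩ := ht'
    have hc : cand Γ W R x u = cand Γ W R x u' := by
      rw [cand_eq_of_avoidReach htar.1.1, cand_eq_of_avoidReach htar'.1.1]
      exact cand_eq_of_avoidReach htt'
    have htar'' : IsTarget Γ W R ℓ x u t' := by
      unfold IsTarget at htar' ⊢
      rw [hc]; exact htar'
    exact htar.unique hℓ htar''
  calc ({t | Points Γ W R ℓ x t} : Set V).encard ≤ (↑(G.neighborFinset x) : Set V).encard :=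
        Set.encard_le_encard_of_injOn hmaps hinj
    _ = (G.degree x : ℕ∞) := by
        rw [Set.encard_coe_eq_coe_finsetCard, card_neighborFinset_eq_degree]

end Literature.Barriers.CriticalPhenomena
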